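import Summits.QuantumFields.BalabanUV.T4Continuum.Spine.NE7.QLaBlockAvgEML

/-!
# Spine/NE7/QLaBlockAvgLinear — the LINEAR BOOKKEEPING of the (0.4) loops over `SU(N)`: the linearised loop transport decomposes
# as (staircase at `c₋`) + (transported bond) − (staircase at `c₊`) − (segment `c`); the transported bonds have column multiplicity
# `L`; every walk involved is supported in the two blocks of its coarse bond

Cell `pub-balaban-gaps` (YM blitz Y1, track G2, seat `ne7`, generation 8); text of record
`run/shared/lean/pub/pub-balaban-gaps/ne/NE7.md` v8 §4nonies, census rows R52–R54.  Twenty-seventh `Spine/NE7/` file; third of the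
four files `QLaBlockAvgFramedStep` ∕ `QLaBlockAvgEML` ∕ `QLaBlockAvgLinear` ∕ `QLaBlockAvgContraction` of generation 8 (see the first
for WHY).

WHAT IS PROVED ([folklore], kernel-checked, 0 sorry) — the matrix-valued twin of generation 4's abelian bookkeeping
(`QLaAbelianBlockContraction.ph_loopHol` ∕ `loopMean_eq` ∕ `sum_abs_segPh_le`), for the linearised transport `walkLin` of
`QLaBlockAvgFramedStep` (the first-order term of a transport, in the sense of the linear averaging operation (14) of
[Balaban1985Averaging] p. 19) along the loop words `Γ ∪ [x,x′] ∪ (−Γ′) ∪ (−c)` of [Balaban1987RG1] (0.4) (`BlockAveraging.loopWord`):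
* `walkLin_walk_wordRev`: the linearised transport of the reversed walk is MINUS that of the walk;
* `walkLin_loop`: linearised loop transport = staircase(`c₋`) + transported bond − staircase(`c₊`) − segment(`c`);
* `meanLin_loop`: in the mean over the index set `Idx P` of (0.4) the two staircase terms are the staircase MEANS at the two coarse
  sites (the second ordering exchanged for the first by the swap symmetry of the index set) — the coarse-gauge part — and the segment
  term is constant;
* `walkMass_seg_eq`, `sum_segMass_le`: the transported bonds carry, summed over all coarse bonds and the index set, at most
  `L^{1−d} ×` the total variation from the flat configuration (column multiplicity `L`, generation 4's `sum_segBond_le`);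
* support: every walk entering the one-step map at `c` (loops, staircases at `c₋` and `c₊`, the segment) runs in bonds issuing from
  `B(c₋) ∪ B(c₊)` resp. `B(c₊) ∪ B(c₊ + e_{μ₀})` (`BlockAveraging.blockOf_src_of_mem_walk`), their lengths are at most `2(d+1)L`, and a
  double count over coarse bonds costs a factor `d` per block condition (`sum_blockFibre_le`).

HONEST FRAMING.  Lattice-walk combinatorics on the tree's torus; no analysis; nothing of Bałaban's asserted.  (QL-a) NOT IN PRINT;
NE7 NOT proved; spine 0∕9; fixed finite T⁴ — NOT ℝ⁴, NOT infinite volume, NOT a mass gap, NOT Clay.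
-/

noncomputable section

open Finset
open scoped BigOperators Matrix Matrix.Norms.L2Operator

namespace Summit.QuantumFields.BalabanUV.T4Continuum.Spine.NE7

open Literature.MathematicalPhysics.QuantumFieldTheory.Balaban1983to89
open Literature.MathematicalPhysics.QuantumFieldTheory.Balaban1983to89.T4Continuum
open Literature.MathematicalPhysics.QuantumFieldTheory.Balaban1983to89.T4AvgSensitivity
open Literature.MathematicalPhysics.QuantumFieldTheory.Balaban1983to89.T4AvgDerivBound
open Literature.MathematicalPhysics.QuantumFieldTheory.Balaban1983to89.BlockAveraging (Idx off off_bounds loopHol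
  blockOf_src_of_mem_walk)

section SUN

variable {n : Type*} [Fintype n] [DecidableEq n] [Nonempty n]
variable {P : Params} {j : ℕ}

/-! ## §1 Reversal and the loop decomposition of the linearised transport -/

omit [Nonempty n] in
/-- THE REVERSED WALK HAS THE OPPOSITE LINEARISED TRANSPORT: `Lin(−Γ) = −Lin(Γ)` (each bond is met once in the opposite direction;
cf. the tree's `holAt_walk_wordRev` `U(−Γ) = U(Γ)⁻¹`). [cite: Balaban1985Averaging, (14) p.19] -/
theorem walkLin_walk_wordRev (V : GaugeField P j (Matrix.specialUnitaryGroup n ℂ)) : ∀ (x : Site P j) (w : List (Letter P.d)),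
    walkLin V (walk (walkEnd x w) (wordRev w)) = -walkLin V (walk x w)
  | x, [] => by simp [walk, walkEnd, wordRev]
  | x, (μ, true) :: w => by
    have h1 : wordRev ((μ, true) :: w) = wordRev w ++ [(μ, false)] := by rw [wordRev_cons]; rfl
    rw [h1]
    simp only [walkEnd, walk]
    rw [walk_append, walkLin_append, walkLin_walk_wordRev V (x.shift μ) w, walkEnd_walkEnd_wordRev]
    simp only [walk, walkLin_cons, walkLin_nil, stepLin, Site.unshift_shift, Bool.false_eq_true, ↓reduceIte, add_zero]
    abel
  | x, (μ, false) :: w => by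
    have h1 : wordRev ((μ, false) :: w) = wordRev w ++ [(μ, true)] := by rw [wordRev_cons]; rfl
    rw [h1]
    simp only [walkEnd, walk]
    rw [walk_append, walkLin_append, walkLin_walk_wordRev V (x.unshift μ) w, walkEnd_walkEnd_wordRev]
    simp only [walk, walkLin_cons, walkLin_nil, stepLin, Bool.false_eq_true, ↓reduceIte, add_zero]
    abel

/-- THE LINEARISED STAIRCASE TRANSPORT at the coarse site `y` for offset `r` and ordering `σ` (`Γ ∈ G(y, x)`, [Balaban1987RG1] p. 252).
[cite: Balaban1987RG1, (0.3) p.252] -/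
def stairLin (V : GaugeField P j (Matrix.specialUnitaryGroup n ℂ)) (y : Site P (j + 1)) (i : Idx P) : MatA n :=
  walkLin V (walk (emb y) (stairWord i.2.1 (off i.1)))

/-- THE LINEARISED TRANSPORTED BOND `[x, x′]`, `x = blockSite c₋ r` ([Balaban1987RG1] p. 252). [cite: Balaban1987RG1, (0.4) p.253] -/
def segLin (V : GaugeField P j (Matrix.specialUnitaryGroup n ℂ)) (c : PBond P (j + 1)) (r : Fin P.d → Fin P.L) : MatA n :=
  walkLin V (walk (Site.blockSite c.src r) (List.replicate P.L (c.dir, true)))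

/-- THE LINEARISED SEGMENT of the coarse bond `c` itself (the straight line from `emb c₋` to `emb c₊`; `AveragingRT.axialAvg`).
[cite: Balaban1987RG1, (0.4) p.253] -/
def axLin (V : GaugeField P j (Matrix.specialUnitaryGroup n ℂ)) (c : PBond P (j + 1)) : MatA n :=
  walkLin V (walk (emb c.src) (List.replicate P.L (c.dir, true)))

omit [Nonempty n] in
/-- **THE LINEARISED LOOP TRANSPORT DECOMPOSES** (standing range): `Lin(Γ ∪ [x,x′] ∪ (−Γ′) ∪ (−c)) = stair(c₋) + seg − stair(c₊) −
ax(c)` — generation 4's `ph_loopHol` with matrix-valued linear parts. [folklore] -/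
theorem walkLin_loop (hj : j + 1 ≤ P.m + P.K) (V : GaugeField P j (Matrix.specialUnitaryGroup n ℂ)) (c : PBond P (j + 1)) (i : Idx P) :
    walkLin V (walk (emb c.src) (loopWord P.L c.dir (off i.1) i.2.1 i.2.2))
      = stairLin V c.src i + segLin V c i.1 - stairLin V c.tgt ⟨i.1, i.2.2, i.2.1⟩ - axLin V c := by
  obtain ⟨r, σ, σ'⟩ := i
  have h1 : walkEnd (emb c.src) (stairWord σ (off r)) = Site.blockSite c.src r := walkEnd_emb_stairWord _ _ _
  have h2 : walkEnd (Site.blockSite c.src r) (List.replicate P.L (c.dir, true)) =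
      walkEnd (emb c.tgt) (stairWord σ' (off r)) := by
    rw [walkEnd_blockSite_replicate hj, walkEnd_emb_stairWord]; rfl
  have hrev : List.replicate P.L (c.dir, false) = wordRev (List.replicate P.L (c.dir, true)) := by
    rw [wordRev_replicate]; rfl
  have h4 : emb c.tgt = walkEnd (emb c.src) (List.replicate P.L (c.dir, true)) := (walkEnd_replicate_L c.src c.dir).symm
  dsimp only [stairLin, segLin, axLin]
  rw [loopWord, walk_append, walkLin_append, walk_append, walkLin_append, walk_append, walkLin_append, h1, h2,
    walkLin_walk_wordRev, walkEnd_walkEnd_wordRev, hrev, h4, walkLin_walk_wordRev, ← h4]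
  abel

/-! ## §2 Means over the index set of (0.4) -/

/-- THE STAIRCASE MEAN of the linearised transports at the coarse site `y` (the linear part of the FRAME `λ(V, y)` of the sequel; a
function of the coarse SITE only). [folklore] -/
def stairMeanLin (V : GaugeField P j (Matrix.specialUnitaryGroup n ℂ)) (y : Site P (j + 1)) : MatA n :=
  ((Fintype.card (Idx P) : ℂ))⁻¹ • ∑ i : Idx P, stairLin V y i

/-- THE MEAN TRANSPORTED BOND (linearised): `|Idx|⁻¹ Σ_i segLin(c, r_i)` — the only term of the framed one-step map to first order.
[folklore] -/
def segMeanLin (V : GaugeField P j (Matrix.specialUnitaryGroup n ℂ)) (c : PBond P (j + 1)) : MatA n :=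
  ((Fintype.card (Idx P) : ℂ))⁻¹ • ∑ i : Idx P, segLin V c i.1

omit [Nonempty n] in
/-- The staircase sum with the SECOND ordering equals the one with the first (swap symmetry of the index set). [folklore] -/
theorem sum_stairLin_swap (V : GaugeField P j (Matrix.specialUnitaryGroup n ℂ)) (y : Site P (j + 1)) :
    ∑ i : Idx P, stairLin V y ⟨i.1, i.2.2, i.2.1⟩ = ∑ i : Idx P, stairLin V y i :=
  Fintype.sum_equiv ((Equiv.refl _).prodCongr (Equiv.prodComm _ _)) _ _ fun _ => rfl

omit [Nonempty n] in
/-- **THE MEAN LINEARISED LOOP TRANSPORT, RESOLVED**: `|Idx|⁻¹ Σ_i Lin(loop_i) = stairMean(c₋) + segMean(c) − stairMean(c₊) − ax(c)`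
(generation 4's `loopMean_eq`). [folklore] -/
theorem meanLin_loop (hj : j + 1 ≤ P.m + P.K) (V : GaugeField P j (Matrix.specialUnitaryGroup n ℂ)) (c : PBond P (j + 1)) :
    ((Fintype.card (Idx P) : ℂ))⁻¹ • ∑ i : Idx P, walkLin V (walk (emb c.src) (loopWord P.L c.dir (off i.1) i.2.1 i.2.2))
      = stairMeanLin V c.src + segMeanLin V c - stairMeanLin V c.tgt - axLin V c := by
  have hN : (Fintype.card (Idx P) : ℂ) ≠ 0 := Nat.cast_ne_zero.mpr Fintype.card_ne_zero
  simp only [walkLin_loop hj, Finset.sum_sub_distrib, Finset.sum_add_distrib, sum_stairLin_swap, Finset.sum_const,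
    Finset.card_univ, smul_sub, smul_add, stairMeanLin, segMeanLin]
  congr 1
  rw [← Nat.cast_smul_eq_nsmul ℂ, smul_smul, inv_mul_cancel₀ hN, one_smul]

/-! ## §3 The transported bonds: mass and column multiplicity `L` -/

/-- THE MASS OF A STRAIGHT WALK of `m` steps `+e_μ` from `x` is the sum of the deviations of the bonds `⟨x + t e_μ, μ⟩`, `t < m`
(generation 4's `ph_holAt_replicate`). [folklore] -/
theorem walkMass_replicate (V : GaugeField P j (Matrix.specialUnitaryGroup n ℂ)) (x : Site P j) (μ : Fin P.d) :
    ∀ m : ℕ, walkMass V (walk x (List.replicate m (μ, true))) = ∑ t ∈ Finset.range m, dist1 (V ⟨Function.update x μ (x μ + t), μ⟩)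
  | 0 => by simp [walk]
  | m + 1 => by
    rw [List.replicate_succ', walk_append, walkMass_append, walkMass_replicate V x μ m, Finset.sum_range_succ,
      walkEnd_replicate_true]
    simp [walk, walkMass]

/-- The mass of the transported bond `[x, x′]` is the sum over its `L` bonds `segBond c r t`. [folklore] -/
theorem walkMass_seg_eq (V : GaugeField P j (Matrix.specialUnitaryGroup n ℂ)) (c : PBond P (j + 1)) (r : Fin P.d → Fin P.L) :
    walkMass V (walk (Site.blockSite c.src r) (List.replicate P.L (c.dir, true)))
      = ∑ t ∈ Finset.range P.L, dist1 (V (segBond c r t)) := by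
  rw [walkMass_replicate]; rfl

/-- The total variation from the flat configuration is the sum of the bond deviations. [folklore] -/
theorem tv_one_eq {G : Type*} [GaugeGroup G] (V : GaugeField P j G) : tv 1 V = ∑ b : PBond P j, dist1 (V b) := by
  unfold tv
  exact Finset.sum_congr rfl fun b _ => by rw [bdist_def, show (1 : GaugeField P j G) b = 1 from rfl, inv_one, one_mul]

/-- **THE COLUMN BOUND**: summed over all coarse bonds and the whole index set, the masses of the transported bonds carry at most
`|S_d × S_d| · L ·` (the total variation from the flat configuration) — multiplicity `L` per fine bond (generation 4's
`sum_segBond_le`; [Balaban1985Averaging] (156)/(138) at the flat configuration, `L·L^{−d} = L^{1−d}`). [cite: Balaban1985Averaging, (156) p.42] -/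
theorem sum_segMass_le (hj : j + 1 ≤ P.m + P.K) (V : GaugeField P j (Matrix.specialUnitaryGroup n ℂ)) :
    ∑ c : PBond P (j + 1), ∑ i : Idx P, walkMass V (walk (Site.blockSite c.src i.1) (List.replicate P.L (c.dir, true)))
      ≤ (Fintype.card (Equiv.Perm (Fin P.d) × Equiv.Perm (Fin P.d)) : ℝ) * ((P.L : ℝ) * tv 1 V) := by
  set cP : ℝ := (Fintype.card (Equiv.Perm (Fin P.d) × Equiv.Perm (Fin P.d)) : ℝ) with hcP
  have hcP0 : 0 ≤ cP := Nat.cast_nonneg _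
  have hswap : ∀ c : PBond P (j + 1),
      ∑ r : Fin P.d → Fin P.L, ∑ t ∈ Finset.range P.L, dist1 (V (segBond c r t))
        = ∑ t ∈ Finset.range P.L, ∑ r : Fin P.d → Fin P.L, dist1 (V (segBond c r t)) := fun c => Finset.sum_comm
  rw [tv_one_eq]
  calc ∑ c : PBond P (j + 1), ∑ i : Idx P, walkMass V (walk (Site.blockSite c.src i.1) (List.replicate P.L (c.dir, true)))
      = ∑ c : PBond P (j + 1), cP * ∑ r : Fin P.d → Fin P.L, ∑ t ∈ Finset.range P.L, dist1 (V (segBond c r t)) :=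
        Finset.sum_congr rfl fun c _ => by
          rw [sum_idx_of_fst (fun r => walkMass V (walk (Site.blockSite c.src r) (List.replicate P.L (c.dir, true))))]
          congr 1
          exact Finset.sum_congr rfl fun r _ => walkMass_seg_eq V c r
    _ = cP * ∑ c : PBond P (j + 1), ∑ r : Fin P.d → Fin P.L, ∑ t ∈ Finset.range P.L, dist1 (V (segBond c r t)) := by
        rw [Finset.mul_sum]
    _ = cP * ∑ t ∈ Finset.range P.L, ∑ c : PBond P (j + 1), ∑ r : Fin P.d → Fin P.L, dist1 (V (segBond c r t)) := by
        rw [Finset.sum_congr rfl fun c _ => hswap c, Finset.sum_comm]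
    _ ≤ cP * ∑ _t ∈ Finset.range P.L, ∑ b : PBond P j, dist1 (V b) :=
        mul_le_mul_of_nonneg_left
          (Finset.sum_le_sum fun t _ => sum_segBond_le hj t (fun b => dist1 (V b)) fun _ => GaugeGroup.dist1_nonneg _) hcP0
    _ = cP * ((P.L : ℝ) * ∑ b : PBond P j, dist1 (V b)) := by rw [Finset.sum_const, Finset.card_range, nsmul_eq_mul]

/-- `|Idx|⁻¹ · |S_d × S_d| · L = θ = L^{1−d}` (`|Idx| = L^d·|S_d × S_d|`). [folklore] -/
theorem card_idx_inv_mul (P : Params) :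
    (Fintype.card (Idx P) : ℝ)⁻¹ * ((Fintype.card (Equiv.Perm (Fin P.d) × Equiv.Perm (Fin P.d)) : ℝ) * (P.L : ℝ)) = theta P := by
  have hP : (0 : ℝ) < Fintype.card (Equiv.Perm (Fin P.d) × Equiv.Perm (Fin P.d)) := Nat.cast_pos.mpr Fintype.card_pos
  have hL : (0 : ℝ) < (P.L : ℝ) ^ P.d := by have := P.L_pos; positivity
  rw [card_idx, theta]
  field_simp

/-- **THE MEAN TRANSPORTED-BOND MASS SUMS TO `θ·tv(1,V)`** over all coarse bonds: `Σ_c |Idx|⁻¹ Σ_i mass([x_i, x_i′]) ≤ θ · tv(1, V)`,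
`θ = L^{1−d}`. [folklore] -/
theorem sum_mean_segMass_le (hj : j + 1 ≤ P.m + P.K) (V : GaugeField P j (Matrix.specialUnitaryGroup n ℂ)) :
    ∑ c : PBond P (j + 1), (Fintype.card (Idx P) : ℝ)⁻¹ *
        ∑ i : Idx P, walkMass V (walk (Site.blockSite c.src i.1) (List.replicate P.L (c.dir, true)))
      ≤ theta P * tv 1 V := by
  rw [← Finset.mul_sum, ← card_idx_inv_mul P, mul_assoc]
  exact mul_le_mul_of_nonneg_left (by simpa only [mul_assoc] using sum_segMass_le hj V) (inv_nonneg.mpr (Nat.cast_nonneg _))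

/-! ## §4 Supports and lengths of the walks; the double count over coarse bonds -/

/-- THE BLOCK SUM at a coarse site: the total deviation of the fine bonds issuing from `B(y)`. [folklore] -/
def blockSum (V : GaugeField P j (Matrix.specialUnitaryGroup n ℂ)) (y : Site P (j + 1)) : ℝ :=
  ∑ b ∈ Finset.univ.filter (fun b : PBond P j => blockOf b.src = y), dist1 (V b)

/-- Block sums are non-negative. [folklore] -/
theorem blockSum_nonneg (V : GaugeField P j (Matrix.specialUnitaryGroup n ℂ)) (y : Site P (j + 1)) : 0 ≤ blockSum V y :=
  Finset.sum_nonneg fun _ _ => GaugeGroup.dist1_nonneg _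

/-- A bond issuing from `B(y)` deviates by at most the block sum. [folklore] -/
theorem dist1_le_blockSum (V : GaugeField P j (Matrix.specialUnitaryGroup n ℂ)) {y : Site P (j + 1)} {b : PBond P j}
    (hb : blockOf b.src = y) : dist1 (V b) ≤ blockSum V y :=
  Finset.single_le_sum (f := fun b => dist1 (V b)) (fun _ _ => GaugeGroup.dist1_nonneg _)
    (Finset.mem_filter.mpr ⟨Finset.mem_univ b, hb⟩)

/-- THE MASS OF A WALK SUPPORTED IN TWO BLOCKS is at most its length times the sum of the two block sums. [folklore] -/
theorem walkMass_le_of_support (V : GaugeField P j (Matrix.specialUnitaryGroup n ℂ)) {y y' : Site P (j + 1)} :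
    ∀ γ : List (LStep P j), (∀ s ∈ γ, blockOf s.bond.src = y ∨ blockOf s.bond.src = y') →
      walkMass V γ ≤ γ.length * (blockSum V y + blockSum V y')
  | [], _ => by simp
  | s :: γ, h => by
    rw [walkMass_cons, List.length_cons, Nat.cast_succ, add_mul, one_mul, add_comm]
    refine add_le_add (walkMass_le_of_support V γ fun s' hs' => h s' (List.mem_cons_of_mem _ hs')) ?_
    have h0 := blockSum_nonneg V y
    have h0' := blockSum_nonneg V y'
    rcases h s List.mem_cons_self with hs | hs
    · exact (dist1_le_blockSum V hs).trans (le_add_of_nonneg_right h0')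
    · exact (dist1_le_blockSum V hs).trans (le_add_of_nonneg_left h0)

omit [Nonempty n] in
/-- The length of the runs of a staircase word is at most (number of axes listed) × (bound on the offsets). [folklore] -/
theorem length_stairRuns_le {d : ℕ} (m : Fin d → ℤ) {h : ℕ} (hm : ∀ a, (m a).natAbs ≤ h) :
    ∀ as : List (Fin d), (stairRuns m as).length ≤ as.length * h
  | [] => by simp [stairRuns]
  | a :: as => by
    rw [stairRuns, List.length_append, List.length_cons, Nat.succ_mul, add_comm (as.length * h)]
    refine add_le_add ?_ (length_stairRuns_le m hm as)
    rw [axisRun, List.length_replicate]; exact hm a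

omit [Nonempty n] in
/-- A staircase word of (0.4) has length at most `d·L` (each offset `|n_ν| ≤ (L−1)/2 ≤ L`). [folklore] -/
theorem length_stairWord_le (σ : Equiv.Perm (Fin P.d)) (r : Fin P.d → Fin P.L) : (stairWord σ (off r)).length ≤ P.d * P.L := by
  have hb : ∀ a, (off r a).natAbs ≤ P.L := fun a => by
    have := off_bounds r a
    have hL : ((P.L - 1) / 2 : ℕ) ≤ P.L := (Nat.div_le_self _ _).trans (Nat.sub_le _ _)
    omega
  refine (length_stairRuns_le (off r) hb _).trans ?_
  rw [List.length_map, List.length_finRange]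

omit [Nonempty n] in
/-- A loop word of (0.4) has length at most `2(d+1)L`. [folklore] -/
theorem length_loopWord_le (μ : Fin P.d) (r : Fin P.d → Fin P.L) (σ σ' : Equiv.Perm (Fin P.d)) :
    (loopWord P.L μ (off r) σ σ').length ≤ 2 * (P.d + 1) * P.L := by
  have h1 := length_stairWord_le (P := P) σ r
  have h2 := length_stairWord_le (P := P) σ' r
  simp only [loopWord, List.length_append, List.length_replicate, wordRev, List.length_reverse, List.length_map]
  nlinarith

/-- The centre offset `r₀ = ((L−1)/2, …)` has `off r₀ = 0`, so its staircase words are empty. [folklore] -/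
def centreOff (P : Params) : Fin P.d → Fin P.L := fun _ => ⟨(P.L - 1) / 2, by have := P.hL.2; omega⟩

omit [Nonempty n] in
/-- `off (centreOff P) = 0`. [folklore] -/
theorem off_centreOff (P : Params) : off (centreOff P) = 0 := by
  funext ν; simp [off, centreOff]

omit [Nonempty n] in
/-- The staircase word of the zero offset is empty. [folklore] -/
theorem stairWord_zero {d : ℕ} (σ : Equiv.Perm (Fin d)) : stairWord σ (0 : Fin d → ℤ) = [] := by
  unfold stairWord
  suffices h : ∀ as : List (Fin d), stairRuns (0 : Fin d → ℤ) as = [] from h _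
  intro as
  induction as with
  | nil => rfl
  | cons a as ih => simp [stairRuns, axisRun, ih]

omit [Nonempty n] in
/-- EVERY BOND OF A STAIRCASE WALK at `y` issues from `B(y) ∪ B(y + e_μ)` for any direction `μ` (the staircase is a prefix of the loop
word at `⟨y, μ⟩`, whose bonds `BlockAveraging.blockOf_src_of_mem_walk` locates; standing range). [folklore] -/
theorem blockOf_src_of_mem_stairWalk (hj : j + 1 ≤ P.m + P.K) (y : Site P (j + 1)) (μ : Fin P.d) (i : Idx P) (s : LStep P j)
    (hs : s ∈ walk (emb y) (stairWord i.2.1 (off i.1))) :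
    blockOf s.bond.src = (⟨y, μ⟩ : PBond P (j + 1)).src ∨ blockOf s.bond.src = (⟨y, μ⟩ : PBond P (j + 1)).tgt := by
  refine blockOf_src_of_mem_walk hj ⟨y, μ⟩ i s ?_
  rw [loopWord, walk_append]
  exact List.mem_append_left _ hs

omit [Nonempty n] in
/-- EVERY BOND OF THE SEGMENT WALK of `c` issues from `B(c₋) ∪ B(c₊)` (the segment is a prefix of the loop word with the centre offset).
[folklore] -/
theorem blockOf_src_of_mem_axWalk (hj : j + 1 ≤ P.m + P.K) (c : PBond P (j + 1)) (s : LStep P j)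
    (hs : s ∈ walk (emb c.src) (List.replicate P.L (c.dir, true))) :
    blockOf s.bond.src = c.src ∨ blockOf s.bond.src = c.tgt := by
  refine blockOf_src_of_mem_walk hj c ⟨centreOff P, 1, 1⟩ s ?_
  dsimp only
  rw [off_centreOff, loopWord, stairWord_zero, List.nil_append, walk_append]
  exact List.mem_append_left _ hs

omit [Nonempty n] in
/-- EVERY BOND OF THE TRANSPORTED-BOND WALK `[x, x′]` issues from `B(c₋) ∪ B(c₊)` (a middle piece of the loop word). [folklore] -/
theorem blockOf_src_of_mem_segWalk (hj : j + 1 ≤ P.m + P.K) (c : PBond P (j + 1)) (i : Idx P) (s : LStep P j)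
    (hs : s ∈ walk (Site.blockSite c.src i.1) (List.replicate P.L (c.dir, true))) :
    blockOf s.bond.src = c.src ∨ blockOf s.bond.src = c.tgt := by
  refine blockOf_src_of_mem_walk hj c i s ?_
  rw [loopWord, walk_append, walkEnd_emb_stairWord, walk_append]
  exact List.mem_append_right _ (List.mem_append_left _ hs)

/-- **THE DOUBLE COUNT OVER COARSE BONDS**: if `c ↦ (f c, dir c)` is injective (the maps `c ↦ c₋`, `c ↦ c₊`, `c ↦ c₊ + e_{μ₀}` are
such), then `Σ_c blockSum(V, f c) ≤ d · tv(1, V)` — every fine bond is counted at most once per direction. [folklore] -/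
theorem sum_blockSum_le (V : GaugeField P j (Matrix.specialUnitaryGroup n ℂ)) (f : PBond P (j + 1) → Site P (j + 1))
    (hf : Function.Injective fun c : PBond P (j + 1) => (f c, c.dir)) :
    ∑ c : PBond P (j + 1), blockSum V (f c) ≤ P.d * tv 1 V := by
  classical
  rw [tv_one_eq]
  have hcount : ∀ z : Site P (j + 1), ((Finset.univ.filter fun c : PBond P (j + 1) => f c = z).card : ℝ) ≤ P.d := fun z => by
    have h := Finset.card_le_card_of_injOn (s := Finset.univ.filter fun c : PBond P (j + 1) => f c = z)
      (t := (Finset.univ : Finset (Fin P.d))) (fun c => c.dir) (fun _ _ => Finset.mem_univ _) (by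
        intro c hc c' hc' hdir
        have hz : f c = f c' := by
          rw [(Finset.mem_filter.mp (Finset.mem_coe.mp hc)).2, (Finset.mem_filter.mp (Finset.mem_coe.mp hc')).2]
        exact hf (Prod.ext hz hdir))
    rw [Finset.card_univ, Fintype.card_fin] at h
    exact_mod_cast h
  calc ∑ c : PBond P (j + 1), blockSum V (f c)
      = ∑ c : PBond P (j + 1), ∑ b : PBond P j, if blockOf b.src = f c then dist1 (V b) else 0 :=
        Finset.sum_congr rfl fun c _ => by rw [blockSum, Finset.sum_filter]
    _ = ∑ b : PBond P j, ∑ c : PBond P (j + 1), if blockOf b.src = f c then dist1 (V b) else 0 := Finset.sum_comm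
    _ = ∑ b : PBond P j, ((Finset.univ.filter fun c : PBond P (j + 1) => f c = blockOf b.src).card : ℝ) * dist1 (V b) :=
        Finset.sum_congr rfl fun b _ => by
          have hset : (Finset.univ.filter fun c : PBond P (j + 1) => blockOf b.src = f c)
              = Finset.univ.filter fun c : PBond P (j + 1) => f c = blockOf b.src :=
            Finset.filter_congr fun c _ => eq_comm
          rw [← Finset.sum_filter, Finset.sum_const, nsmul_eq_mul, hset]
    _ ≤ ∑ b : PBond P j, (P.d : ℝ) * dist1 (V b) :=
        Finset.sum_le_sum fun _ _ => mul_le_mul_of_nonneg_right (hcount _) (GaugeGroup.dist1_nonneg _)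
    _ = P.d * ∑ b : PBond P j, dist1 (V b) := by rw [Finset.mul_sum]

omit [Nonempty n] in
/-- `c ↦ (c₋, dir c)` is injective. [folklore] -/
theorem injective_src_dir : Function.Injective fun c : PBond P (j + 1) => (c.src, c.dir) := by
  rintro ⟨y, μ⟩ ⟨y', μ'⟩ h
  simp only [Prod.mk.injEq] at h
  obtain ⟨rfl, rfl⟩ := h; rfl

omit [Nonempty n] in
/-- `c ↦ (c₊, dir c)` is injective (`c₋ = c₊ − e_{dir c}`). [folklore] -/
theorem injective_tgt_dir : Function.Injective fun c : PBond P (j + 1) => (c.tgt, c.dir) := by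
  rintro ⟨y, μ⟩ ⟨y', μ'⟩ h
  simp only [Prod.mk.injEq, PBond.tgt] at h
  obtain ⟨hy, rfl⟩ := h
  have : y = y' := by rw [← Site.unshift_shift y μ, hy, Site.unshift_shift]
  subst this; rfl

omit [Nonempty n] in
/-- `c ↦ (c₊ + e_{dir c}, dir c)` is injective. [folklore] -/
theorem injective_tgt_shift_dir : Function.Injective fun c : PBond P (j + 1) => (c.tgt.shift c.dir, c.dir) := by
  rintro ⟨y, μ⟩ ⟨y', μ'⟩ h
  simp only [Prod.mk.injEq, PBond.tgt] at h
  obtain ⟨hy, rfl⟩ := h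
  have : y = y' := by
    have h2 : y.shift μ = y'.shift μ := by rw [← Site.unshift_shift (y.shift μ) μ, hy, Site.unshift_shift]
    rw [← Site.unshift_shift y μ, h2, Site.unshift_shift]
  subst this; rfl

end SUN

end Summit.QuantumFields.BalabanUV.T4Continuum.Spine.NE7

end
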